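import Mathlib

/-!
# V4U root chart of `J₄`: the two integral translation invariants `γ″`, `δ″` (every characteristic)

(crux stmt-ResolutionOfSingularities-15640 `WildQuotients.WildQuotientResolution`, line `Sketch`,
sector `|G| = p`; programme V4U of `L/w45c/CHAIN.md` v5 («then» of row stub-1: the `μ₃` root chart
of `Bl_{I₆} 𝔸ⁿ` for the Jordan block `J₄`, res-L1-w45c-stub-4 FINDING 2026-08-27T02:15:15Z);
[OURS · L1 W4.5c] — NOT a statement of any manuscript; replaces the role of no printed item.
Route-independent: `import Mathlib` only; design-independent: `σ_U` is given ABSTRACTLY by its law.)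

On the weighted root chart (`x₀ = ρ³`, `x₁ = ρ²β`, `x₂ = ργ`, weights `(3,2,1)`) the Jordan block
`J₄` (`x₁ ↦ x₁ + x₀`, `x₂ ↦ x₂ + x₁`, `x₃ ↦ x₃ + x₂`) acts by the TRIANGULAR translation
`σ_U : ρ ↦ ρ, β ↦ β + ρ, γ ↦ γ + ρβ, δ ↦ δ + ργ` (passengers fixed). Besides `ρ` and the
Artin–Schreier element `N = β^p − ρ^{p−1}β` (`ToricExit.fixedPoints_translate`), the action has the
two INTEGRAL invariants
* `γ″ = 2γ − β² + ρβ` (`rootChart4_gamma_invariant`; `= 2 c′` of V3U),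
* `δ″ = 6δ − 3γ″β − β³ + 3ρβ² − 2ρ²β` (`rootChart4_delta_invariant`),
valid in EVERY characteristic (pure polynomial identities); for `p ≥ 5` (`6 ∈ k×`) the substitution
`x_c ↦ γ″/2`, `x_d ↦ δ″/6` conjugates `σ_U` to the pure translation of `β` over
`k[ρ, γ″, δ″, passengers]`, so `k[ρ, β, γ, δ, …]^{σ_U} = k[ρ, N, γ″, δ″, …]`, and the `μ₃`-weights
(`ρ, β ↦ 1`, `γ ↦ 2`, `δ ↦ 0` in `ZMod 3`; `N ↦ p̄`, `γ″ ↦ 2`, `δ″ ↦ 0`) exhibit the chart quotient as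
the cyclic quotient singularity `⅓(1, p̄, 2) × 𝔸` — input for CHAIN v6 (V4U).
-/

-- single-problem summit: the doubled namespace component `ResolutionOfSingularities` is forced
set_option linter.dupNamespace false

noncomputable section

open MvPolynomial

namespace Summit.ResolutionOfSingularities.ResolutionOfSingularities.Theorems.WildQuotientResolution.ToricExit

variable {R : Type*} [CommRing R] {n : ℕ} (σU : MvPolynomial (Fin n) R →+* MvPolynomial (Fin n) R)
  (a b c d : Fin n) (ha : σU (X a) = X a) (hb : σU (X b) = X b + X a)
  (hc : σU (X c) = X c + X a * X b) (hd : σU (X d) = X d + X a * X c)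

include ha hb hc in
/-- **`γ″ = 2γ − β² + ρβ` is invariant** under `ρ ↦ ρ`, `β ↦ β + ρ`, `γ ↦ γ + ρβ` (every
characteristic; for `2 ∈ R×` it is `2 c′`, `c′ = γ − ½(β² − ρβ)` of V3U). [folklore] -/
theorem rootChart4_gamma_invariant :
    σU (2 * X c - X b ^ 2 + X a * X b) = 2 * X c - X b ^ 2 + X a * X b := by
  rw [map_add, map_sub, map_mul, map_pow, map_mul, map_ofNat, ha, hb, hc]
  ring

include ha hb hc hd in
/-- **`δ″ = 6δ − 3γ″β − β³ + 3ρβ² − 2ρ²β` is invariant** under the triangular translation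
`ρ ↦ ρ`, `β ↦ β + ρ`, `γ ↦ γ + ρβ`, `δ ↦ δ + ργ` (every characteristic; for `6 ∈ R×` the invariant
`δ″/6 = δ − c′β − (β³/6 − ρβ²/2 + ρ²β/3)` has leading term `δ`). [folklore] -/
theorem rootChart4_delta_invariant :
    σU (6 * X d - 3 * (2 * X c - X b ^ 2 + X a * X b) * X b - X b ^ 3 + 3 * (X a * X b ^ 2) -
        2 * (X a ^ 2 * X b)) =
      6 * X d - 3 * (2 * X c - X b ^ 2 + X a * X b) * X b - X b ^ 3 + 3 * (X a * X b ^ 2) -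
        2 * (X a ^ 2 * X b) := by
  simp only [map_add, map_sub, map_mul, map_pow, map_ofNat, ha, hb, hc, hd]
  ring

include ha hb in
/-- The Artin–Schreier element `N = β^p − ρ^{p−1} β` is invariant in characteristic `p` (as in V3U;
restated for a ring ENDOmorphism `σ_U` of `R[x]`, `R` any commutative ring of characteristic `p`).
[folklore: Artin–Schreier] -/
theorem rootChart4_artinSchreier (p : ℕ) [Fact p.Prime] [CharP R p] :
    σU (X b ^ p - X a ^ (p - 1) * X b) = X b ^ p - X a ^ (p - 1) * X b := by
  have hp1 : p - 1 + 1 = p := Nat.succ_pred_eq_of_pos (Fact.out : p.Prime).pos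
  rw [map_sub, map_pow, map_mul, map_pow, hb, ha, add_pow_char, mul_add]
  conv_lhs => rw [← pow_succ, hp1]
  ring

end Summit.ResolutionOfSingularities.ResolutionOfSingularities.Theorems.WildQuotientResolution.ToricExit

end
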